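import Mathlib
import Summits.Ventures.PercRepro2.TypedResidualCore
import Summits.Ventures.PercRepro2.TypedResidualDegree

/-!
# The core with an unmarked vertex, modulo the all-marked base (blind cell PercRepro2, p2 g0,
2026-08-25; sub-claim S1, `proofs/subclaims/S1-REDUCTION.md`; the lead's ruling INBOX
2026-08-25T03:40:28Z (3): «K5TypedK3 on five-mark multigraphs — p2's subtraction»)

The ALL-MARKED core instances (every end of every typed edge is one of the five marks) form a
finite base: typed graphs on at most five vertices. Their typed bases are the (5,0)-cell of the
reduced class (`LEAD-TYPED-REDUCTION.md` §2; engine D42, 0 / 92,021,760) — a kernel certificate is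
the next typer seat's target. Here that certificate is a NAMED HYPOTHESIS, exactly in the shape the
certificate must have:

* **`AllMarked`** — every end of every typed edge is a mark;
* **`AllMarkedTRI_all R`** — row 2′TRI on the all-marked fully reduced typed graphs (the
  certificate's statement; NOT a theorem here);
* **`ResidualCoreU`** — `ResidualCore` with a typed edge at an UNMARKED vertex (hence, by
  `Reduced.typedDeg_unmarked`, an unmarked vertex of typed degree `≥ 3`:
  `ResidualCoreU.exists_unmarked`);
* **`HCov_all_of_residualCoreU_all (hK : AllMarkedTRI_all R) : ResidualCoreU_all R → HCov_all R`** —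
  the crux of record from (TRI) on the core instances with an unmarked vertex, once the all-marked
  base is a theorem.

Own code; standard axioms (the all-marked base enters as an explicit hypothesis).
-/

namespace Summit.Ventures.PercRepro2

open UnionCluster

namespace CovForm

namespace TypedRed

section CoreU

variable {V : Type*} {E : Type*} [DecidableEq V] [Fintype E] [DecidableEq E]

/-- Every end of every typed edge is one of the five marks. -/
def AllMarked (ends : E → Sym2 V) (o a₁ a₂ a₃ b : V) (F : Finset E) : Prop :=
  ∀ e ∈ F, ∀ p ∈ ends e, p = o ∨ p = a₁ ∨ p = a₂ ∨ p = a₃ ∨ p = b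

/-- **The core with an unmarked vertex**: a typed edge has an end that is none of the marks. -/
structure ResidualCoreU (ends : E → Sym2 V) (o a₁ a₂ a₃ b : V) (F : Finset E) : Prop where
  core : ResidualCore ends o a₁ a₂ a₃ b F
  unmarked : ∃ e ∈ F, ∃ p ∈ ends e, p ≠ o ∧ p ≠ a₁ ∧ p ≠ a₂ ∧ p ≠ a₃ ∧ p ≠ b

omit [Fintype E] in
/-- A core instance with an unmarked vertex has an unmarked vertex of typed degree at least
three. -/
theorem ResidualCoreU.exists_unmarked {ends : E → Sym2 V} {o a₁ a₂ a₃ b : V} {F : Finset E}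
    (h : ResidualCoreU ends o a₁ a₂ a₃ b F) :
    ∃ p : V, p ≠ o ∧ p ≠ a₁ ∧ p ≠ a₂ ∧ p ≠ a₃ ∧ p ≠ b ∧ 3 ≤ typedDeg ends F p := by
  obtain ⟨e, he, p, hp, hpo, hp1, hp2, hp3, hpb⟩ := h.unmarked
  exact ⟨p, hpo, hp1, hp2, hp3, hpb,
    h.core.residualConR.residualCon.residual.reduced.typedDeg_unmarked hpo hp1 hp2 hp3 hpb he hp⟩

omit [DecidableEq V] [Fintype E] [DecidableEq E] in
/-- Not all-marked means a typed edge with an unmarked end. -/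
theorem exists_unmarked_of_not_allMarked {ends : E → Sym2 V} {o a₁ a₂ a₃ b : V} {F : Finset E}
    (h : ¬ AllMarked ends o a₁ a₂ a₃ b F) :
    ∃ e ∈ F, ∃ p ∈ ends e, p ≠ o ∧ p ≠ a₁ ∧ p ≠ a₂ ∧ p ≠ a₃ ∧ p ≠ b := by
  by_contra hno
  apply h
  intro e he p hp
  by_contra hmark
  apply hno
  refine ⟨e, he, p, hp, ?_, ?_, ?_, ?_, ?_⟩
  · exact fun h' => hmark (Or.inl h')
  · exact fun h' => hmark (Or.inr (Or.inl h'))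
  · exact fun h' => hmark (Or.inr (Or.inr (Or.inl h')))
  · exact fun h' => hmark (Or.inr (Or.inr (Or.inr (Or.inl h'))))
  · exact fun h' => hmark (Or.inr (Or.inr (Or.inr (Or.inr h'))))

end CoreU

section Closure

variable (R : Type*) [Field R] [LinearOrder R] [IsStrictOrderedRing R]

/-- **Row 2′TRI on the ALL-MARKED fully reduced typed graphs** (the statement of the all-marked
certificate; a named hypothesis, NOT a theorem of this file). -/
def AllMarkedTRI_all : Prop :=
  ∀ (V E : Type) [Fintype V] [DecidableEq V] [Fintype E] [DecidableEq E]
    (ends : E → Sym2 V) (o a₁ a₂ a₃ b : V) (F : Finset E) (τ : E → ℕ),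
    (∀ e ∈ F, τ e = 1 ∨ τ e = 2) → Reduced ends o a₁ a₂ a₃ b F →
      AllMarked ends o a₁ a₂ a₃ b F →
      0 ≤ typedCount F (fun _ => false) τ
        (K3 ends o a₁ a₂ a₃ b : Config E → Config E → Config E → R)

/-- **Row 2′TRI on `ResidualCoreU`, over every finite graph.** -/
def ResidualCoreU_all : Prop :=
  ∀ (V E : Type) [Fintype V] [DecidableEq V] [Fintype E] [DecidableEq E]
    (ends : E → Sym2 V) (o a₁ a₂ a₃ b : V) (F : Finset E) (τ : E → ℕ),
    (∀ e ∈ F, τ e = 1 ∨ τ e = 2) → ResidualCoreU ends o a₁ a₂ a₃ b F →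
      0 ≤ typedCount F (fun _ => false) τ
        (K3 ends o a₁ a₂ a₃ b : Config E → Config E → Config E → R)

/-- **The crux of record from (TRI) on the core instances with an unmarked vertex**, given the
all-marked base. -/
theorem HCov_all_of_residualCoreU_all (hK : AllMarkedTRI_all R) (hc : ResidualCoreU_all R) :
    HCov_all R := by
  refine HCov_all_of_residualCore_all R ?_
  intro V E _ _ _ _ ends o a₁ a₂ a₃ b F τ hτ hcore
  by_cases hall : AllMarked ends o a₁ a₂ a₃ b F
  · exact hK V E ends o a₁ a₂ a₃ b F τ hτ hcore.residualConR.residualCon.residual.reduced hall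
  · exact hc V E ends o a₁ a₂ a₃ b F τ hτ ⟨hcore, exists_unmarked_of_not_allMarked hall⟩

end Closure

end TypedRed

end CovForm

end Summit.Ventures.PercRepro2
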